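import Summits.Ventures.QEC.Census.CertCoverBatch
import Summits.Ventures.QEC.Census.BB.A1s_n168_k6_00e732a0.CoreDefs
import HarnessLib

set_option Elab.async false
set_option maxRecDepth 200000

/-!
# `[[168,6,16]]` one-level cover certificate of `A1s_n168_k6_00e732a0` — LEVEL-1→0 coset problems 268…298 (deep problems [29] excluded: `ProbDeep*.lean`) as COMPACT data
(`ProbData`: U, f, σ, y₀, allow; qec-type-10 `CertCoverBatch.mkCoset` rebuilds each `CosetProb` in the kernel) + their verdict
`probsOK cov covR hx hx1 D1 lxd 14` (one `decide +kernel`; 31 problems, depths f=0:29 f=1:1 f=2:1 f=3:0, est. 149.5 s).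
qec-search-1 g5 (pattern of search-9 g5 `Probs*`); data from JSON `level10.problems` (sha256 202b3dfe2448a360…). Data + decided check; KERNEL.
-/

namespace Summit.Ventures.QEC.Census.A1s_n168_k6_00e732a0

open Matrix Summit.Ventures.QEC.Census Literature.InformationTheory.QuantumCodes

/-- Problems 268…298 (31): `⟨U, f, σ, y₀, allow⟩`. -/
def probs06 : List ProbData := [
    ⟨23622281963126833873154, 0, 657953, 23613058591089982178560, []⟩,
    ⟨23662705370408421982212, 0, 2709, 23621200196242541940740, []⟩,
    ⟨28638736842804831455329, 0, 3185, 28629495456379009635794, []⟩,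
    ⟨37861969307809102201873, 0, 78345, 37788164316977799183773, []⟩,
    ⟨37869157558442650502160, 0, 0, 0, [0]⟩,
    ⟨37880686263586173489156, 0, 137347, 27679123314382471170, []⟩,
    ⟨37936027023302050472992, 0, 0, 0, [0]⟩,
    ⟨37936458912216729518080, 2, 364561, 576601489791909920, [131104, 134348800, 604462909807314587353088]⟩,
    ⟨37954329199936186353668, 0, 364561, 18446889209248745508, []⟩,
    ⟨38083454015158935953985, 0, 4128, 37788306105581625385492, []⟩,
    ⟨38250053842807598088256, 0, 299187, 38249476959842829729824, []⟩,
    ⟨38378743806266607403158, 0, 266339, 9511611210614900095, []⟩,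
    ⟨38383353917236705240064, 1, 5185, 604421491338180037634, []⟩,
    ⟨39010437805560960782336, 0, 1052821, 37788336507078109037841, []⟩,
    ⟨39190838634580203798784, 0, 103065, 39190260907190505308192, []⟩,
    ⟨40150070453963348509184, 0, 890113, 578853289605595680, []⟩,
    ⟨40153986367269401288704, 0, 53589, 40140115245163840798752, []⟩,
    ⟨40154247435216174196224, 0, 0, 0, [0]⟩,
    ⟨40892108860558754719232, 0, 528721, 40287689621041863206914, []⟩,
    ⟨42584336846208836861969, 0, 78345, 42510531855379680278941, []⟩,
    ⟨42810583615398339420160, 0, 1051168, 5017514390252316262400, [0]⟩,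
    ⟨43105474322942344036481, 0, 1118816, 4722366553377191660865, []⟩,
    ⟨47251938462895808976896, 0, 269459, 9232379240807139364, []⟩,
    ⟨47382813175334272270464, 0, 1086721, 143011454370231, []⟩,
    ⟨52550452169575915595776, 0, 5185, 590584674055724073525, []⟩,
    ⟨52845603384288488728576, 0, 1056353, 14466863543407690287381, []⟩,
    ⟨75866923428467986924544, 0, 1058937, 76701931153671200, []⟩,
    ⟨75886464652112591586306, 0, 729122, 75885311449133008290882, []⟩,
    ⟨76160121943507681166368, 0, 1056897, 599807412772794533264, []⟩,
    ⟨76162013778693125636228, 0, 32849, 590295819154932957344, []⟩,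
    ⟨80331031419786591535104, 0, 140061, 36965554813099131040, []⟩]

set_option maxHeartbeats 400000000 in
/-- Every problem of this chunk passes (`mkCoset` elimination + `cosetOKD` + fast `σ` + depth + `BU`-evenness + label checks). -/
theorem probs06_ok : probsOK A1s_n168_k6_00e732a0.cov covR hx hx1 D1 lxd 14 probs06 = true := by
  decide +kernel

/-- Pointwise form. -/
theorem probs06_all : ∀ x ∈ A1s_n168_k6_00e732a0.probs06, probOK cov covR hx hx1 D1 lxd 14 x = true := by
  have h := probs06_ok
  rwa [probsOK, List.all_eq_true] at h

end Summit.Ventures.QEC.Census.A1s_n168_k6_00e732a0
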